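import Mathlib
import HarnessLib.Audit
import Summits.PneNP.PneNP.Theorems.PstarGateU2Coupled
import Summits.PneNP.PneNP.Theorems.PstarGateU2Touch
import Summits.PneNP.PneNP.Theorems.PstarGateU2Budget
import Summits.PneNP.PneNP.Theorems.PstarGateUnitCycleRankSix
import Summits.PneNP.PneNP.Theorems.PstarChordBridgeBundle
import Summits.PneNP.PneNP.Theorems.PstarRankRigidity

/-!
# One GATED chord, node N5 `GateU2X` HOLDS: a doubly-read companion chord leaves at most five core outputs (E2; prover-1 g19)

FRONTIER range-avoidance ladder, rung F-N3 (`stmt-PneNP-19007`), cell `pnp-ideate` (`PstarGateNodesX.GateU2X`); restricted-model proof complexity —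
nothing here bears on `P` versus `NP`.

`N = {e, e'}`, `e` gated by `g₀ = (p, u)`, `e'` doubly read; `W = {x_u = 0}`, chamber `H₁ = {x_u = κ₀ + 1}`.
1. **Rank six is impossible** on either side (`u2_not_rank_six`, `u2_not_rank_six'`): rigidity (`PstarRankRigidity.eq_zero_or_eq_of_rank_six`)
   applied to separation on the chamber makes `u_e + u_{e'}` constant there (`PstarGateU2Coupled.u2_coupled_false`) or one cycle constant on the
   chamber (`const_on_hyperplane` / `avoid_nonempty` / `exists_off_on_chamber`).
2. **Cycles differing only through `u` are impossible** when `Q_{D e}` keeps rank `≥ 4` on `W` (`u2_through_false`): then `u_e + u_{e'}` is AFFINE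
   on the chamber and vanishes on the zeros of `u_e` there, so it is constant (`PstarForcing.not_forced_of_affine`) — `u2_coupled_false` again.
3. **Assembly** (`u2_card_le_five`): with `#J₀ ≥ 6` the budget (`PstarGateU2Budget.two_private_of_six_le`) gives two private tree edges; a private
   tree edge lies on BOTH fundamental sets (`PstarGateU2Touch.u2_touch/u2_touch'`, `PstarGateU2Joins.u2_no_bridge`); a third `u`-avoiding edge on
   either cycle would give rank six (`PstarGateUnitCycleRankSix.rank_six_of_private`); so both cycles are the two private edges plus `u`-edges —
   step 2 applies (`rank_four_on_fibre`).

* `gateU2X_holds : GateU2X`.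
-/

set_option linter.dupNamespace false -- `Summit.PneNP.PneNP.…`: summit = sub-problem name (D-0017 single-conjunct layout)

open Finset Module Literature.Computability.Complexity
open scoped symmDiff
open Summit.PneNP.PneNP.Theorems.PstarTyped (Typed)
open Summit.PneNP.PneNP.Theorems.PstarSALevel (varSet BoundaryExpanding SimpleOverlap)
open Summit.PneNP.PneNP.Theorems.PstarGapLinearised (andPair andPair_subset_varSet)
open Summit.PneNP.PneNP.Theorems.PstarChordEndgameTools (mem_andPair_iff)
open Summit.PneNP.PneNP.Theorems.PstarCentreFree (vars_mem_varSet)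
open Summit.PneNP.PneNP.Theorems.PstarCubeIdeals (IsAffineFn IsQuadFn isAffineFn_const)
open Summit.PneNP.PneNP.Theorems.PstarForcing (polar_unique not_forced_of_affine)
open Summit.PneNP.PneNP.Theorems.PstarRankRigidity (eq_zero_or_eq_of_rank_six)
open Summit.PneNP.PneNP.Theorems.PstarProductRank (qform polar)
open Summit.PneNP.PneNP.Theorems.PstarQuadRank (rad)
open Summit.PneNP.PneNP.Theorems.PstarQuadRestrict (quad_restrict)
open Summit.PneNP.PneNP.Theorems.PstarPathRankFibre (coordKer mem_coordKer avoid rank_four_on_fibre rank_restrict_ge polar_eq_polar_avoid)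
open Summit.PneNP.PneNP.Theorems.PstarReadSumset (V2)
open Summit.PneNP.PneNP.Theorems.PstarChordSystem (ChordSystem)
open Summit.PneNP.PneNP.Theorems.PstarChordBridgeTools (privs coef)
open Summit.PneNP.PneNP.Theorems.PstarChordBridge (BridgeData sys Solution Lift)
open Summit.PneNP.PneNP.Theorems.PstarChordBridgeForcing (gam sys_u_eq)
open Summit.PneNP.PneNP.Theorems.PstarChordBridgeCorner (polar_empty)
open Summit.PneNP.PneNP.Theorems.PstarChordBridgeBundle (polar_symmDiff)
open Summit.PneNP.PneNP.Theorems.PstarGateBridge (GateHyp)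
open Summit.PneNP.PneNP.Theorems.PstarGateHyperplane (const_on_hyperplane)
open Summit.PneNP.PneNP.Theorems.PstarGateCaseTLocal (u_add)
open Summit.PneNP.PneNP.Theorems.PstarGateFibreRank (avoid_nonempty)
open Summit.PneNP.PneNP.Theorems.PstarGateUnitCycleRankSix (rank_six_of_private)
open Summit.PneNP.PneNP.Theorems.PstarGateNodes (GateData)
open Summit.PneNP.PneNP.Theorems.PstarGateNodesX
open Summit.PneNP.PneNP.Theorems.PstarGateU2Joins (u2_no_bridge)
open Summit.PneNP.PneNP.Theorems.PstarGateU2Coupling (u2_sep)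
open Summit.PneNP.PneNP.Theorems.PstarGateU2BranchB (exists_off_on_chamber)
open Summit.PneNP.PneNP.Theorems.PstarGateU2Coupled (u2_coupled_false)
open Summit.PneNP.PneNP.Theorems.PstarGateU2Touch (u2_touch u2_touch')
open Summit.PneNP.PneNP.Theorems.PstarGateU2Budget (two_private_of_six_le)

namespace Summit.PneNP.PneNP.Theorems.PstarGateU2Final

variable {n m : ℕ}

/-- From a chamber statement on `x₀ + W` to the hyperplane `{x_u = c}`. -/
private theorem of_chamber {u : Fin n} {c : ZMod 2} {S : (Fin n → ZMod 2) → Prop}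
    (h : ∀ w : coordKer ({u} : Finset (Fin n)), S ((Pi.single u c : Fin n → ZMod 2) + (w : Fin n → ZMod 2))) :
    ∀ x : Fin n → ZMod 2, x u = c → S x := by
  intro x hx
  have hw : x + Pi.single u c ∈ coordKer ({u} : Finset (Fin n)) := by
    rw [mem_coordKer]
    intro w hw
    rw [mem_singleton] at hw
    subst hw
    rw [Pi.add_apply, hx, Pi.single_eq_same, CharTwo.add_self_eq_zero]
  have h' := h ⟨x + Pi.single u c, hw⟩
  have hxx : (Pi.single u c : Fin n → ZMod 2) + (x + Pi.single u c) = x := by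
    ext v
    rw [Pi.add_apply, Pi.add_apply, add_comm (x v), ← add_assoc, CharTwo.add_self_eq_zero, zero_add]
  simpa only [hxx] using h'

/-- **Rank six on the gated side is impossible.** -/
theorem u2_not_rank_six (I : LocalMap 4 n m) (hI : I.IsPure xorAndPred) (hT : Typed I) (hS : SimpleOverlap I) {r₀ : ℕ}
    (hB : BoundaryExpanding r₀ I) {B : BridgeData n m} {e g₀ : Fin m} {u : Fin n} {κ₀ : ZMod 2} (hD : GateDataX I r₀ B e g₀ u κ₀)
    {e' : Fin m} (hN : B.N = {e, e'}) (hne : e' ≠ e)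
    (hU2 : ∀ a, (sys I B).ρ e' a ≠ 0 ∧ (sys I B).ρ' e' a ≠ 0 ∧ (sys I B).ρ e' a ≠ (sys I B).ρ' e' a)
    (h6 : finrank (ZMod 2) (rad ((polar (B.D e) (fun j => I.vars j 2) (fun j => I.vars j 3)).restrict (coordKer ({u} : Finset (Fin n))))) + 6 ≤
      finrank (ZMod 2) (coordKer ({u} : Finset (Fin n)))) : False := by
  classical
  obtain ⟨-, hW, -, -, -, -, -, -, hG, -⟩ := id hD
  have he' : e' ∈ B.N := by rw [hN]; exact mem_insert_of_mem (mem_singleton_self _)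
  have he'D : e' ∉ B.D e' := fun h => (mem_sdiff.1 (hW.hD e' he' h)).2 he'
  set W : Submodule (ZMod 2) (Fin n → ZMod 2) := coordKer ({u} : Finset (Fin n)) with hWdef
  set x₀ : Fin n → ZMod 2 := Pi.single u (κ₀ + 1) with hx₀
  set P : W → ZMod 2 := fun w => (sys I B).u e (x₀ + (w : Fin n → ZMod 2)) with hPdef
  set g : W → ZMod 2 := fun w => (sys I B).u e' (x₀ + (w : Fin n → ZMod 2)) + 1 with hgdef
  have hP : ∀ v w : W, P (v + w) = P v + P w + P 0 +
      ((polar (B.D e) (fun j => I.vars j 2) (fun j => I.vars j 3)).restrict W) v w := quad_restrict (u_add I B e) W x₀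
  have hP' : ∀ v w : W, (sys I B).u e' (x₀ + ((v + w : W) : Fin n → ZMod 2)) = (sys I B).u e' (x₀ + (v : Fin n → ZMod 2)) +
      (sys I B).u e' (x₀ + (w : Fin n → ZMod 2)) + (sys I B).u e' (x₀ + ((0 : W) : Fin n → ZMod 2)) +
      ((polar (B.D e') (fun j => I.vars j 2) (fun j => I.vars j 3)).restrict W) v w := quad_restrict (u_add I B e') W x₀
  have hg : IsQuadFn g := by
    refine ⟨(polar (B.D e') (fun j => I.vars j 2) (fun j => I.vars j 3)).restrict W, fun v w => ?_⟩
    show (sys I B).u e' (x₀ + ((v + w : W) : Fin n → ZMod 2)) + 1 = (sys I B).u e' (x₀ + (v : Fin n → ZMod 2)) + 1 +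
      ((sys I B).u e' (x₀ + (w : Fin n → ZMod 2)) + 1) + ((sys I B).u e' (x₀ + ((0 : W) : Fin n → ZMod 2)) + 1) +
      ((polar (B.D e') (fun j => I.vars j 2) (fun j => I.vars j 3)).restrict W) v w
    rw [hP' v w]
    generalize (sys I B).u e' (x₀ + (v : Fin n → ZMod 2)) = a; generalize (sys I B).u e' (x₀ + (w : Fin n → ZMod 2)) = b
    generalize (sys I B).u e' (x₀ + ((0 : W) : Fin n → ZMod 2)) = c
    generalize ((polar (B.D e') (fun j => I.vars j 2) (fun j => I.vars j 3)).restrict W) v w = s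
    revert a b c s; decide
  have hsep := u2_sep I hI hT hD hN hne hU2
  have hwu : ∀ w : W, (x₀ + (w : Fin n → ZMod 2)) u = κ₀ + 1 := fun w => by
    rw [Pi.add_apply, hx₀, Pi.single_eq_same, (mem_coordKer.1 w.2) u (mem_singleton_self u), add_zero]
  have hZ : ∀ w, P w = 0 → g w = 0 := by
    intro w hw
    have z01 : ∀ t : ZMod 2, t ≠ 0 → t + 1 = 0 := by decide
    exact z01 _ (hsep _ (hwu w) hw)
  rcases eq_zero_or_eq_of_rank_six hP h6 hg hZ with h0 | hq
  · -- `u_{e'} ≡ 1` on the chamber: `D e'` passes through `u`, no avoiding edge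
    have hc : ∀ x : Fin n → ZMod 2, x u = κ₀ + 1 → qform (B.D e') (fun j => I.vars j 2) (fun j => I.vars j 3) x = gam B e' + 1 := by
      refine of_chamber (S := fun x => qform (B.D e') (fun j => I.vars j 2) (fun j => I.vars j 3) x = gam B e' + 1) fun w => ?_
      have h := h0 w
      simp only [hgdef, sys_u_eq] at h
      have e2 : ∀ a Q : ZMod 2, a + Q + 1 = 0 → Q = a + 1 := by decide
      exact e2 _ _ h
    have hthrough := (const_on_hyperplane I hI hS (B.D e') u (κ₀ + 1) _ hc).1
    obtain ⟨j, hj⟩ := avoid_nonempty I hI hS he'D (hW.hDeven e' he') u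
    unfold PstarPathRankFibre.avoid at hj
    obtain ⟨hjD, h2, h3⟩ := mem_filter.1 hj
    rw [mem_singleton] at h2 h3
    rcases hthrough j hjD with h | h
    · exact h2 h
    · exact h3 h
  · -- `u_{e'} + 1 = u_e` on the chamber: coupled
    refine u2_coupled_false I hI hT hS hB hD hN hne hU2 (c₀ := 1) (of_chamber (S := fun x => (sys I B).u e x + (sys I B).u e' x = 1) fun w => ?_)
    have h := hq w
    simp only [hgdef, hPdef] at h
    have e2 : ∀ a b : ZMod 2, b + 1 = a → a + b = 1 := by decide
    exact e2 _ _ h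

/-- **Rank six on the companion side is impossible.** -/
theorem u2_not_rank_six' (I : LocalMap 4 n m) (hI : I.IsPure xorAndPred) (hT : Typed I) (hS : SimpleOverlap I) {r₀ : ℕ}
    (hB : BoundaryExpanding r₀ I) {B : BridgeData n m} {e g₀ : Fin m} {u : Fin n} {κ₀ : ZMod 2} (hD : GateDataX I r₀ B e g₀ u κ₀)
    {e' : Fin m} (hN : B.N = {e, e'}) (hne : e' ≠ e)
    (hU2 : ∀ a, (sys I B).ρ e' a ≠ 0 ∧ (sys I B).ρ' e' a ≠ 0 ∧ (sys I B).ρ e' a ≠ (sys I B).ρ' e' a)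
    (h6 : finrank (ZMod 2) (rad ((polar (B.D e') (fun j => I.vars j 2) (fun j => I.vars j 3)).restrict (coordKer ({u} : Finset (Fin n))))) + 6 ≤
      finrank (ZMod 2) (coordKer ({u} : Finset (Fin n)))) : False := by
  classical
  obtain ⟨-, hW, -, -, -, -, -, -, hG, -⟩ := id hD
  have he : e ∈ B.N := hG.1
  set W : Submodule (ZMod 2) (Fin n → ZMod 2) := coordKer ({u} : Finset (Fin n)) with hWdef
  set x₀ : Fin n → ZMod 2 := Pi.single u (κ₀ + 1) with hx₀
  set P' : W → ZMod 2 := fun w => (sys I B).u e' (x₀ + (w : Fin n → ZMod 2)) with hP'def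
  set g : W → ZMod 2 := fun w => (sys I B).u e (x₀ + (w : Fin n → ZMod 2)) + 1 with hgdef
  have hP' : ∀ v w : W, P' (v + w) = P' v + P' w + P' 0 +
      ((polar (B.D e') (fun j => I.vars j 2) (fun j => I.vars j 3)).restrict W) v w := quad_restrict (u_add I B e') W x₀
  have hP : ∀ v w : W, (sys I B).u e (x₀ + ((v + w : W) : Fin n → ZMod 2)) = (sys I B).u e (x₀ + (v : Fin n → ZMod 2)) +
      (sys I B).u e (x₀ + (w : Fin n → ZMod 2)) + (sys I B).u e (x₀ + ((0 : W) : Fin n → ZMod 2)) +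
      ((polar (B.D e) (fun j => I.vars j 2) (fun j => I.vars j 3)).restrict W) v w := quad_restrict (u_add I B e) W x₀
  have hg : IsQuadFn g := by
    refine ⟨(polar (B.D e) (fun j => I.vars j 2) (fun j => I.vars j 3)).restrict W, fun v w => ?_⟩
    show (sys I B).u e (x₀ + ((v + w : W) : Fin n → ZMod 2)) + 1 = (sys I B).u e (x₀ + (v : Fin n → ZMod 2)) + 1 +
      ((sys I B).u e (x₀ + (w : Fin n → ZMod 2)) + 1) + ((sys I B).u e (x₀ + ((0 : W) : Fin n → ZMod 2)) + 1) +
      ((polar (B.D e) (fun j => I.vars j 2) (fun j => I.vars j 3)).restrict W) v w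
    rw [hP v w]
    generalize (sys I B).u e (x₀ + (v : Fin n → ZMod 2)) = a; generalize (sys I B).u e (x₀ + (w : Fin n → ZMod 2)) = b
    generalize (sys I B).u e (x₀ + ((0 : W) : Fin n → ZMod 2)) = c
    generalize ((polar (B.D e) (fun j => I.vars j 2) (fun j => I.vars j 3)).restrict W) v w = s
    revert a b c s; decide
  have hsep := u2_sep I hI hT hD hN hne hU2
  have hwu : ∀ w : W, (x₀ + (w : Fin n → ZMod 2)) u = κ₀ + 1 := fun w => by
    rw [Pi.add_apply, hx₀, Pi.single_eq_same, (mem_coordKer.1 w.2) u (mem_singleton_self u), add_zero]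
  have hZ : ∀ w, P' w = 0 → g w = 0 := by
    intro w hw
    by_contra h1
    have z01 : ∀ t : ZMod 2, t + 1 ≠ 0 → t = 0 := by decide
    exact hsep _ (hwu w) (z01 _ h1) hw
  rcases eq_zero_or_eq_of_rank_six hP' h6 hg hZ with h0 | hq
  · -- `u_e ≡ 1` on the chamber: contradicts a chamber zero of `u_e`
    obtain ⟨x, hxu, hxe⟩ := exists_off_on_chamber I hI hS hW he u (κ₀ + 1)
    have h := of_chamber (S := fun x => (sys I B).u e x + 1 = 0) (fun w => h0 w) x hxu
    rw [hxe, zero_add] at h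
    exact one_ne_zero h
  · refine u2_coupled_false I hI hT hS hB hD hN hne hU2 (c₀ := 1) (of_chamber (S := fun x => (sys I B).u e x + (sys I B).u e' x = 1) fun w => ?_)
    have h := hq w
    simp only [hgdef, hP'def] at h
    have e2 : ∀ a b : ZMod 2, a + 1 = b → a + b = 1 := by decide
    exact e2 _ _ h

/-- **Cycles differing only through `u` are impossible** once `Q_{D e}` has rank `≥ 4` on `W`. -/
theorem u2_through_false (I : LocalMap 4 n m) (hI : I.IsPure xorAndPred) (hT : Typed I) (hS : SimpleOverlap I) {r₀ : ℕ}
    (hB : BoundaryExpanding r₀ I) {B : BridgeData n m} {e g₀ : Fin m} {u : Fin n} {κ₀ : ZMod 2} (hD : GateDataX I r₀ B e g₀ u κ₀)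
    {e' : Fin m} (hN : B.N = {e, e'}) (hne : e' ≠ e)
    (hU2 : ∀ a, (sys I B).ρ e' a ≠ 0 ∧ (sys I B).ρ' e' a ≠ 0 ∧ (sys I B).ρ e' a ≠ (sys I B).ρ' e' a)
    (hM : ∀ j ∈ B.D e ∆ B.D e', I.vars j 2 = u ∨ I.vars j 3 = u)
    (h4 : finrank (ZMod 2) (rad ((polar (B.D e) (fun j => I.vars j 2) (fun j => I.vars j 3)).restrict (coordKer ({u} : Finset (Fin n))))) + 4 ≤
      finrank (ZMod 2) (coordKer ({u} : Finset (Fin n)))) : False := by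
  classical
  set W : Submodule (ZMod 2) (Fin n → ZMod 2) := coordKer ({u} : Finset (Fin n)) with hWdef
  set x₀ : Fin n → ZMod 2 := Pi.single u (κ₀ + 1) with hx₀
  set P : W → ZMod 2 := fun w => (sys I B).u e (x₀ + (w : Fin n → ZMod 2)) with hPdef
  set P' : W → ZMod 2 := fun w => (sys I B).u e' (x₀ + (w : Fin n → ZMod 2)) with hP'def
  set Bf := (polar (B.D e) (fun j => I.vars j 2) (fun j => I.vars j 3)).restrict W with hBf
  set Bf' := (polar (B.D e') (fun j => I.vars j 2) (fun j => I.vars j 3)).restrict W with hBf'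
  have hP : ∀ v w : W, P (v + w) = P v + P w + P 0 + Bf v w := quad_restrict (u_add I B e) W x₀
  have hP' : ∀ v w : W, P' (v + w) = P' v + P' w + P' 0 + Bf' v w := quad_restrict (u_add I B e') W x₀
  -- the two polar forms agree on `W`: their sum is the polar form of `Q_{D e ∆ D e'}`, whose edges pass through `u`
  have hsum : ∀ v w : W, Bf v w + Bf' v w = 0 := by
    intro v w
    rw [hBf, hBf', LinearMap.BilinForm.restrict_apply, LinearMap.BilinForm.restrict_apply, LinearMap.domRestrict_apply,
      LinearMap.domRestrict_apply]
    have h := congrArg (fun F : LinearMap.BilinForm (ZMod 2) (Fin n → ZMod 2) => F (v : Fin n → ZMod 2) (w : Fin n → ZMod 2))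
      (polar_symmDiff I (B.D e) (B.D e'))
    simp only [LinearMap.add_apply] at h
    rw [← h, polar_eq_polar_avoid I (B.D e ∆ B.D e') {u} v.2 w.2]
    have hav : avoid I (B.D e ∆ B.D e') {u} = ∅ := by
      unfold PstarPathRankFibre.avoid
      refine filter_eq_empty_iff.2 fun j hj h => ?_
      rcases hM j hj with hu | hu
      · exact h.1 (mem_singleton.2 hu)
      · exact h.2 (mem_singleton.2 hu)
    rw [hav, polar_empty]
    rfl
  -- so `α = P + P' + 1` is affine on `W`
  have hα : IsAffineFn (fun w : W => P w + P' w + 1 + 1) := by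
    intro v w
    show P (v + w) + P' (v + w) + 1 + 1 = P v + P' v + 1 + 1 + (P w + P' w + 1 + 1) + (P 0 + P' 0 + 1 + 1)
    rw [hP v w, hP' v w]
    have h := hsum v w
    generalize P v = a at h ⊢; generalize P w = b; generalize P 0 = c; generalize P' v = a'; generalize P' w = b'; generalize P' 0 = c'
    generalize Bf v w = s at h ⊢; generalize Bf' v w = s' at h ⊢
    have e : ∀ a b c a' b' c' s s' : ZMod 2, s + s' = 0 →
        a + b + c + s + (a' + b' + c' + s') + 1 + 1 = a + a' + 1 + 1 + (b + b' + 1 + 1) + (c + c' + 1 + 1) := by decide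
    exact e _ _ _ _ _ _ _ _ h
  have hsep := u2_sep I hI hT hD hN hne hU2
  have hwu : ∀ w : W, (x₀ + (w : Fin n → ZMod 2)) u = κ₀ + 1 := fun w => by
    rw [Pi.add_apply, hx₀, Pi.single_eq_same, (mem_coordKer.1 w.2) u (mem_singleton_self u), add_zero]
  -- `P` is `1` wherever `α + 1 = 0`: so `α + 1` never vanishes (`not_forced_of_affine`)
  have hZ : ∀ w : W, P w + P' w + 1 + 1 = 0 → P w = 1 := by
    intro w hw
    by_contra hP0
    have z01 : ∀ t : ZMod 2, t ≠ 1 → t = 0 := by decide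
    have h0 := z01 _ hP0
    have h1 : P' w = 1 := by
      have z01' : ∀ t : ZMod 2, t ≠ 0 → t = 1 := by decide
      exact z01' _ (hsep _ (hwu w) h0)
    rw [h0, h1] at hw
    exact absurd hw (by decide)
  have hall := not_forced_of_affine hα hP h4 hZ
  refine u2_coupled_false I hI hT hS hB hD hN hne hU2 (c₀ := 1) (of_chamber (S := fun x => (sys I B).u e x + (sys I B).u e' x = 1) fun w => ?_)
  have h := hall w
  have e2 : ∀ a b : ZMod 2, a + b + 1 + 1 = 1 → a + b = 1 := by decide
  exact e2 _ _ h

/-- **The bound: a doubly-read companion chord leaves at most five core outputs.** -/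
theorem u2_card_le_five (I : LocalMap 4 n m) (hI : I.IsPure xorAndPred) (hT : Typed I) (hS : SimpleOverlap I) {r₀ : ℕ}
    (hB : BoundaryExpanding r₀ I) {B : BridgeData n m} {e g₀ : Fin m} {u : Fin n} {κ₀ : ZMod 2} (hD : GateDataX I r₀ B e g₀ u κ₀)
    {e' : Fin m} (hN : B.N = {e, e'}) (hne : e' ≠ e)
    (hU2 : ∀ a, (sys I B).ρ e' a ≠ 0 ∧ (sys I B).ρ' e' a ≠ 0 ∧ (sys I B).ρ e' a ≠ (sys I B).ρ' e' a) : B.J₀.card ≤ 5 := by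
  classical
  by_contra h6
  push Not at h6
  obtain ⟨hXc, hW, hr, hd₁, -, -, -, -, hG, hg₀, hgv, -⟩ := id hD
  have he : e ∈ B.N := hG.1
  have he' : e' ∈ B.N := by rw [hN]; exact mem_insert_of_mem (mem_singleton_self _)
  have hg₀J : g₀ ∉ B.J₀ := fun h => disjoint_left.1 hd₁ hg₀ h
  have hu_g₀ : u ∈ varSet I g₀ := by
    rcases hgv with ⟨-, h3⟩ | ⟨h2, -⟩
    · exact h3 ▸ vars_mem_varSet I g₀ 3
    · exact h2 ▸ vars_mem_varSet I g₀ 2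
  obtain ⟨π₁, hπ₁F, π₂, hπ₂F, hne12, hp₁, hp₂⟩ := two_private_of_six_le I hB hD hN hne h6
  -- a private tree edge avoids `u`, sees no other output's AND variables, and lies on both fundamental sets
  have key : ∀ π ∈ B.J₀ \ B.N, (∀ j' ∈ insert g₀ B.J₀, j' ≠ π → I.vars π 2 ∉ varSet I j' ∧ I.vars π 3 ∉ varSet I j') →
      (I.vars π 2 ≠ u ∧ I.vars π 3 ≠ u) ∧
      (∀ D ⊆ B.J₀, π ∉ D → I.vars π 2 ∉ D.biUnion (andPair I) ∧ I.vars π 3 ∉ D.biUnion (andPair I)) ∧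
      π ∈ B.D e ∧ π ∈ B.D e' := by
    intro π hπF hp
    have hπJ : π ∈ B.J₀ := (mem_sdiff.1 hπF).1
    have hgπ := hp g₀ (mem_insert_self _ _) (fun h => hg₀J (h ▸ hπJ))
    have hu2 : I.vars π 2 ≠ u := fun h => hgπ.1 (h ▸ hu_g₀)
    have hu3 : I.vars π 3 ≠ u := fun h => hgπ.2 (h ▸ hu_g₀)
    have hout : ∀ D ⊆ B.J₀, π ∉ D → I.vars π 2 ∉ D.biUnion (andPair I) ∧ I.vars π 3 ∉ D.biUnion (andPair I) := by
      intro D hDJ hπD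
      constructor
      · intro h
        obtain ⟨j', hj', hv⟩ := mem_biUnion.1 h
        exact (hp j' (mem_insert_of_mem (hDJ hj')) (fun h' => hπD (h' ▸ hj'))).1 (andPair_subset_varSet I j' hv)
      · intro h
        obtain ⟨j', hj', hv⟩ := mem_biUnion.1 h
        exact (hp j' (mem_insert_of_mem (hDJ hj')) (fun h' => hπD (h' ▸ hj'))).2 (andPair_subset_varSet I j' hv)
    have hDeJ : B.D e ⊆ B.J₀ := (hW.hD e he).trans sdiff_subset
    have hDe'J : B.D e' ⊆ B.J₀ := (hW.hD e' he').trans sdiff_subset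
    refine ⟨⟨hu2, hu3⟩, hout, ?_⟩
    by_cases hDe : π ∈ B.D e <;> by_cases hDe' : π ∈ B.D e'
    · exact ⟨hDe, hDe'⟩
    · exact (u2_touch I hI hT hS hD hN hne hU2 hDe hu2 hu3 (hout _ hDe'J hDe').1 (hout _ hDe'J hDe').2).elim
    · exact (u2_touch' I hI hT hS hD hN hne hU2 hDe' hu2 hu3 (hout _ hDeJ hDe).1 (hout _ hDeJ hDe).2).elim
    · exact (u2_no_bridge I hI hT hS hB hD hN hne hU2 hπF hDe hDe' (Or.inl (hout _ hDe'J hDe').1)).elim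
  obtain ⟨⟨h1u2, h1u3⟩, hout₁, h1e, h1e'⟩ := key π₁ hπ₁F hp₁
  obtain ⟨⟨h2u2, h2u3⟩, hout₂, h2e, h2e'⟩ := key π₂ hπ₂F hp₂
  -- rank six from a third avoiding edge
  have hsix : ∀ (c : Fin m), c ∈ B.N → π₁ ∈ B.D c → π₂ ∈ B.D c → ∀ k ∈ B.D c, k ≠ π₁ → k ≠ π₂ → I.vars k 2 ≠ u → I.vars k 3 ≠ u →
      finrank (ZMod 2) (rad ((polar (B.D c) (fun j => I.vars j 2) (fun j => I.vars j 3)).restrict (coordKer ({u} : Finset (Fin n))))) + 6 ≤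
        finrank (ZMod 2) (coordKer ({u} : Finset (Fin n))) := by
    intro c hc h1 h2 k hk hk1 hk2 hku2 hku3
    have hDcJ : B.D c ⊆ B.J₀ := (hW.hD c hc).trans sdiff_subset
    have hmem : ∀ {j}, j ∈ B.D c → I.vars j 2 ≠ u → I.vars j 3 ≠ u → j ∈ avoid I (B.D c) {u} := by
      intro j hj hj2 hj3
      unfold PstarPathRankFibre.avoid
      exact mem_filter.2 ⟨hj, by rwa [mem_singleton], by rwa [mem_singleton]⟩
    have hsub : avoid I (B.D c) {u} ⊆ insert g₀ B.J₀ := fun j hj => mem_insert_of_mem (hDcJ (mem_filter.1 hj).1)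
    have h := rank_six_of_private I hI hS (hmem h1 h1u2 h1u3) (hmem h2 h2u2 h2u3) (hmem hk hku2 hku3) hne12 (Ne.symm hk1) (Ne.symm hk2)
      (fun j' hj' hne' => hp₁ j' (hsub hj') hne') (fun j' hj' hne' => hp₂ j' (hsub hj') hne')
    have hrg := rank_restrict_ge I (B.D c) ({u} : Finset (Fin n))
    omega
  -- hence both cycles are `{π₁, π₂}` plus `u`-edges
  have havD : ∀ k ∈ B.D e, k ≠ π₁ → k ≠ π₂ → I.vars k 2 = u ∨ I.vars k 3 = u := by
    intro k hk hk1 hk2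
    by_contra hnot
    push Not at hnot
    exact u2_not_rank_six I hI hT hS hB hD hN hne hU2 (hsix e he h1e h2e k hk hk1 hk2 hnot.1 hnot.2)
  have havD' : ∀ k ∈ B.D e', k ≠ π₁ → k ≠ π₂ → I.vars k 2 = u ∨ I.vars k 3 = u := by
    intro k hk hk1 hk2
    by_contra hnot
    push Not at hnot
    exact u2_not_rank_six' I hI hT hS hB hD hN hne hU2 (hsix e' he' h1e' h2e' k hk hk1 hk2 hnot.1 hnot.2)
  have hM : ∀ j ∈ B.D e ∆ B.D e', I.vars j 2 = u ∨ I.vars j 3 = u := by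
    intro j hj
    rw [Finset.mem_symmDiff] at hj
    rcases hj with ⟨hjD, hjD'⟩ | ⟨hjD', hjD⟩
    · exact havD j hjD (fun h => hjD' (h ▸ h1e')) (fun h => hjD' (h ▸ h2e'))
    · exact havD' j hjD' (fun h => hjD (h ▸ h1e)) (fun h => hjD (h ▸ h2e))
  -- and `Q_{D e}` has rank `≥ 4` on `W` (two disjoint private avoiding edges)
  have hmem : ∀ {j}, j ∈ B.D e → I.vars j 2 ≠ u → I.vars j 3 ≠ u → j ∈ avoid I (B.D e) {u} := by
    intro j hj hj2 hj3
    unfold PstarPathRankFibre.avoid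
    exact mem_filter.2 ⟨hj, by rwa [mem_singleton], by rwa [mem_singleton]⟩
  have hDeJ : B.D e ⊆ B.J₀ := (hW.hD e he).trans sdiff_subset
  have hπ₁A := hmem h1e h1u2 h1u3
  have hπ₂A := hmem h2e h2u2 h2u3
  have hπ₂J : π₂ ∈ B.J₀ := (mem_sdiff.1 hπ₂F).1
  have h12' := hp₁ π₂ (mem_insert_of_mem hπ₂J) (Ne.symm hne12)
  have h4 : finrank (ZMod 2) (rad ((polar (B.D e) (fun j => I.vars j 2) (fun j => I.vars j 3)).restrict (coordKer ({u} : Finset (Fin n)))))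
      + 4 ≤ finrank (ZMod 2) (coordKer ({u} : Finset (Fin n))) := by
    refine rank_four_on_fibre I hI hS (B.D e) {u} ⟨π₁, hπ₁A⟩ ?_ ?_
    · rintro ⟨d, hd⟩
      have hd1 := hd π₁ hπ₁A
      have hd2 := hd π₂ hπ₂A
      rcases (mem_andPair_iff I π₁ d).1 hd1 with h | h
      · exact h12'.1 (h ▸ andPair_subset_varSet I π₂ hd2)
      · exact h12'.2 (h ▸ andPair_subset_varSet I π₂ hd2)
    · intro hall
      obtain ⟨j, hj, hjne, hv⟩ := hall π₁ hπ₁A 2 (by decide)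
      have hjJ : j ∈ B.J₀ := hDeJ (mem_filter.1 hj).1
      exact (hp₁ j (mem_insert_of_mem hjJ) hjne).1 (andPair_subset_varSet I j hv)
  exact u2_through_false I hI hT hS hB hD hN hne hU2 hM h4

/-- **N5 (v2) `GateU2X` HOLDS.** -/
theorem gateU2X_holds : GateU2X := by
  intro n m r I hI hT hS hB B e g₀ u κ₀ hD e' hN hne hU2
  exact u2_card_le_five I hI hT hS hB hD hN hne hU2

end Summit.PneNP.PneNP.Theorems.PstarGateU2Final
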